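import Literature.NumberTheory.Transcendental.FormIntegrationFlat
import Literature.NumberTheory.Transcendental.FormIntegrationCharts
import HarnessLib

/-!
# Top de Rham cohomology of a closed connected oriented manifold: `∫ : Hⁿ_dR(M) ≅ ℝ`

Topic: integration of differential forms; this file discharges the named fact
`Literature.Geometry.Kaehler.deRhamCohomology.integral_bijective` of
`Literature/NumberTheory/Transcendental/FormIntegration.lean` (Lee (2013), Thm. 17.30–17.31):
on a compact boundaryless connected nonempty manifold with a continuous orientation family,
integration `H^n_dR(M) →ₗ[ℝ] ℝ` is bijective. As in the definition of
`deRhamCohomology.integral`, additivity of `∫_M` (`MForm.integral_add`) and Stokes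
(`MForm.integral_eq_zero_of_mem_exactSmoothForms`) enter as the hypotheses of the fact.

## Main statements (all proved)

* `Literature.NumberTheory.Transcendental.exists_chartSign_const_ball`: oriented coordinate balls (Lee (2013), Prop. 15.6).
* `Literature.Geometry.Kaehler.MForm.mem_exactSmoothForms_of_integral_eq_zero`: **local exactness** — a smooth top form
  supported in an oriented coordinate ball with `∫_M α = 0` is exact (the flat compactly
  supported Poincaré lemma `Literature.NumberTheory.Transcendental.exists_extDeriv_eq_smul_of_integral_eq_zero` transported by
  `Literature.Geometry.Kaehler.MForm.ofChart`; dimension `0` separately).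
* `Literature.Geometry.Kaehler.MForm.exists_bump`: chart bump forms with nonzero integral.
* `Literature.Geometry.Kaehler.MForm.exists_sub_smul_mem_exactSmoothForms`: the chain step — bump forms at points with
  meeting coordinate balls are proportional modulo exact forms.
* `Literature.Geometry.Kaehler.MForm.mem_exactSmoothForms_of_integral_eq_zero_of_connected`: Lee (2013), Thm. 17.30,
  injectivity: `∫_M α = 0 ⇒ α` exact, by the clopen-set form of Lee's chain-of-charts
  induction and a finite smooth partition of unity.
* `Literature.deRhamCohomology.integral_bijective_holds : deRhamCohomology.integral_bijective o`.

## Proof architecture (vs. Lee)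

Lee proves Thm. 17.30 for compactly supported cohomology of a connected oriented manifold by
induction over a countable chain of charts `U₁, U₂, …` with `M_k ∩ U_{k+1} ≠ ∅`, using
Lemma 17.27 (whose proof uses the ordinary Poincaré lemma and Stokes on balls). Here `M` is
compact, so: (1) every point `p` gets an oriented coordinate ball `V p` and a bump form `β p`
(`∫ β p ≠ 0`); (2) local exactness in one ball is Lemma 17.27 for `p = n`, proved directly by
fibre integration (`FormIntegrationFlat`); (3) the set of `p` with `β p ≡ c • β p₀ (mod exact)`
is open and closed by the chain step, hence all of `M`; (4) a finite partition of unity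
subordinate to the balls writes `α ≡ D • β p₀ (mod exact)` and `0 = ∫ α = D ∫ β p₀` forces
`D = 0`. Surjectivity: `∫ β p₀ ≠ 0`.

## References

* J. M. Lee, *Introduction to Smooth Manifolds*, 2nd ed., GTM 218, Springer (2013),
  Lemma 17.27 (p. 483), Thm. 17.30 (p. 485), Thm. 17.31 (p. 486), Prop. 15.6 (p. 415).
-/

noncomputable section

open scoped Manifold ContDiff Topology
open Bundle Set Module MeasureTheory Function Filter

namespace Literature.NumberTheory.Transcendental

section TopCohomology

variable {E : Type*} [NormedAddCommGroup E] [NormedSpace ℝ E] [FiniteDimensional ℝ E]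
  {n : ℕ} [Fact (finrank ℝ E = n)]
  {H : Type*} [TopologicalSpace H] {I : ModelWithCorners ℝ E H}
  {M : Type*} [TopologicalSpace M] [ChartedSpace H M]
  [MeasurableSpace E] [BorelSpace E] [T2Space M] [SigmaCompactSpace M] [IsManifold I ∞ M]
  [CompactSpace M] [I.Boundaryless]
  (o : (x : M) → Orientation ℝ (TangentSpace I x) (Fin n))

omit [I.Boundaryless] in
/-- Linearity of `∫_M` on smooth top forms in the form `∫ (α - c • β) = ∫ α - c ∫ β`, from the
named fact `MForm.integral_add` (hypothesis) and `MForm.integral_smul`. [folklore] -/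
theorem _root_.Literature.Geometry.Kaehler.MForm.integral_sub_smul (ho : IsContinuousOrientation o) (hadd : Literature.Geometry.Kaehler.MForm.integral_add o)
    {α β : Literature.Geometry.Kaehler.MForm I M ℝ n} (hα : Literature.Geometry.Kaehler.IsSmoothForm α) (hβ : Literature.Geometry.Kaehler.IsSmoothForm β) (c : ℝ) :
    (α - c • β).integral o = α.integral o - c * β.integral o := by
  rw [sub_eq_add_neg, ← neg_smul, hadd ho hα (hβ.smul (-c)), Literature.Geometry.Kaehler.MForm.integral_smul]
  ring

omit [MeasurableSpace E] [BorelSpace E] [T2Space M] [SigmaCompactSpace M] [IsManifold I ∞ M]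
  [CompactSpace M] in
/-- **Positively/negatively oriented coordinate balls.** For a continuous orientation family,
every point `p` has a closed coordinate ball (for the sup-norm of the coordinates in the
reference basis) around its chart point, contained in the chart target, on which the chart sign
is a nonzero constant `ε`. Lee (2013), Prop. 15.6 (continuous pointwise orientations have
oriented charts). [cite: LeeSmoothManifolds2013, Prop. 15.6] -/
theorem exists_chartSign_const_ball (ho : IsContinuousOrientation o) (p : M) :
    ∃ r : ℝ, 0 < r ∧ ∃ ε : ℝ, ε ≠ 0 ∧
      (modelBasis E n).equivFunL ⁻¹' Metric.closedBall
          ((modelBasis E n).equivFunL (extChartAt I p p)) r ⊆ (extChartAt I p).target ∧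
      ∀ y ∈ (modelBasis E n).equivFunL ⁻¹' Metric.closedBall
          ((modelBasis E n).equivFunL (extChartAt I p p)) r, chartSign o p y = ε := by
  set A := (modelBasis E n).equivFunL with hA
  set y₀ := extChartAt I p p with hy₀
  have h1 : ∀ᶠ y in 𝓝 y₀, (chartSign o p y = chartSign o p y₀ ∧ chartSign o p y ≠ 0) ∧
      y ∈ (extChartAt I p).target := by
    have := ho p
    rw [I.range_eq_univ, nhdsWithin_univ] at this
    exact this.and (extChartAt_target_mem_nhds p)
  have h2 : ∀ᶠ w in 𝓝 (A y₀), (chartSign o p (A.symm w) = chartSign o p y₀ ∧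
      chartSign o p (A.symm w) ≠ 0) ∧ A.symm w ∈ (extChartAt I p).target := by
    have ht : Tendsto A.symm (𝓝 (A y₀)) (𝓝 y₀) := by
      have := A.symm.continuous.tendsto (A y₀)
      rwa [ContinuousLinearEquiv.symm_apply_apply] at this
    exact ht.eventually h1
  obtain ⟨r', hr', hball⟩ := Metric.eventually_nhds_iff_ball.1 h2
  refine ⟨r' / 2, by positivity, chartSign o p y₀, (h1.self_of_nhds).1.2, ?_, ?_⟩
  · intro y hy
    have := (hball (A y) (Metric.closedBall_subset_ball (by linarith) hy)).2
    rwa [ContinuousLinearEquiv.symm_apply_apply] at this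
  · intro y hy
    have := (hball (A y) (Metric.closedBall_subset_ball (by linarith) hy)).1.1
    rwa [ContinuousLinearEquiv.symm_apply_apply] at this

omit [T2Space M] [SigmaCompactSpace M] [IsManifold I ∞ M] [CompactSpace M] [I.Boundaryless] in
/-- The integral of a function over a zero-dimensional model space is its value at `0`
(the Haar measure of the empty basis is the Dirac mass). [folklore] -/
theorem integral_eq_apply_zero_of_finrank_zero [Fact (finrank ℝ E = 0)] (f : E → ℝ) :
    ∫ y, f y ∂(modelBasis E 0).addHaar = f 0 := by
  have hE : Subsingleton E := Module.finrank_zero_iff.1 (Fact.out : finrank ℝ E = 0)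
  have hf : f = fun _ ↦ f 0 := funext fun y ↦ by rw [Subsingleton.elim y 0]
  have huniv : (modelBasis E 0).addHaar univ = 1 := by
    have h1 := (modelBasis E 0).addHaar_self
    have h2 : (parallelepiped (modelBasis E 0) : Set E) = univ :=
      Subsingleton.eq_univ_of_nonempty ⟨0, (mem_parallelepiped_iff _ _).2
        ⟨0, ⟨le_rfl, zero_le_one⟩, by simp⟩⟩
    rwa [h2] at h1
  rw [hf, integral_const, smul_eq_mul, Measure.real, huniv]
  simp

/-- **Local exactness, dimension zero**: a smooth `0`-form supported in a chart with vanishing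
integral is zero (the degenerate case of Lee (2013), Thm. 17.30: a connected `0`-manifold is a
point). [cite: LeeSmoothManifolds2013, Thm. 17.30] -/
theorem _root_.Literature.Geometry.Kaehler.MForm.eq_zero_of_integral_eq_zero_of_finrank_zero [Fact (finrank ℝ E = 0)]
    (o : (x : M) → Orientation ℝ (TangentSpace I x) (Fin 0)) {p : M} {ε : ℝ} (hε : ε ≠ 0)
    {α : Literature.Geometry.Kaehler.MForm I M ℝ 0} (hα : Literature.Geometry.Kaehler.IsSmoothForm α) {K : Set E} (hKc : IsCompact K)
    (hKt : K ⊆ (extChartAt I p).target)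
    (hK : ∀ x, α x ≠ 0 → x ∈ (extChartAt I p).source ∧ extChartAt I p x ∈ K)
    (hsign : ∀ y ∈ K, chartSign o p y = ε) (hint : α.integral o = 0) : α = 0 := by
  have hE : Subsingleton E := Module.finrank_zero_iff.1 (Fact.out : finrank ℝ E = 0)
  have h1 := Literature.Geometry.Kaehler.MForm.integral_eq_chartDensity o p (basisDetL_self (modelBasis E 0)) hα hKc hKt hK
    hsign
  rw [hint, integral_eq_apply_zero_of_finrank_zero] at h1
  have h0 : Literature.Geometry.Kaehler.MForm.chartDensity p α 0 = 0 := by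
    have := mul_eq_zero.1 h1.symm
    exact this.resolve_left hε
  have hcd : (fun y ↦ Literature.Geometry.Kaehler.MForm.chartDensity p α y • basisDetL (modelBasis E 0)) =
      (0 : ℝ) • fun _ ↦ basisDetL (modelBasis E 0) := by
    funext y
    rw [Subsingleton.elim y 0, h0]
    rfl
  have hα0 : ∀ x ∉ (extChartAt I p).source, α x = 0 := fun x hx ↦ by
    by_contra h
    exact hx (hK x h).1
  rw [Literature.Geometry.Kaehler.MForm.eq_ofChart_chartDensity_smul p (basisDetL_self (modelBasis E 0)) hα0, hcd,
    Literature.Geometry.Kaehler.MForm.ofChart_smul, zero_smul]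

/-- **Local exactness, positive dimension** (the inductive base of Lee (2013), Thm. 17.30 via
Lemma 17.27): a smooth top form supported in the preimage of a compact subset of an oriented
coordinate ball, with vanishing integral, is the exterior derivative of a smooth form
(supported in the same chart). [cite: LeeSmoothManifolds2013, Thm. 17.30] -/
theorem _root_.Literature.Geometry.Kaehler.MForm.mem_exactSmoothForms_of_integral_eq_zero_succ {m : ℕ} [Fact (finrank ℝ E = m + 1)]
    (o : (x : M) → Orientation ℝ (TangentSpace I x) (Fin (m + 1))) {p : M} {r ε : ℝ}
    (hε : ε ≠ 0)
    (hsub : (modelBasis E (m + 1)).equivFunL ⁻¹' Metric.closedBall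
      ((modelBasis E (m + 1)).equivFunL (extChartAt I p p)) r ⊆ (extChartAt I p).target)
    (hsign : ∀ y ∈ (modelBasis E (m + 1)).equivFunL ⁻¹' Metric.closedBall
      ((modelBasis E (m + 1)).equivFunL (extChartAt I p p)) r, chartSign o p y = ε)
    {α : Literature.Geometry.Kaehler.MForm I M ℝ (m + 1)} (hα : Literature.Geometry.Kaehler.IsSmoothForm α) {K : Set E} (hKc : IsCompact K)
    (hKb : K ⊆ (modelBasis E (m + 1)).equivFunL ⁻¹' Metric.ball
      ((modelBasis E (m + 1)).equivFunL (extChartAt I p p)) r)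
    (hK : ∀ x, α x ≠ 0 → x ∈ (extChartAt I p).source ∧ extChartAt I p x ∈ K)
    (hint : α.integral o = 0) :
    ∃ β : Literature.Geometry.Kaehler.MForm I M ℝ m, Literature.Geometry.Kaehler.IsSmoothForm β ∧ Literature.Geometry.Kaehler.mextDeriv β = α := by
  set e := modelBasis E (m + 1) with he
  set A := e.equivFunL with hA
  set c := A (extChartAt I p p) with hc
  set D := basisDetL e with hDdef
  have hD : D e = 1 := basisDetL_self e
  have hKcl : K ⊆ A ⁻¹' Metric.closedBall c r := hKb.trans (preimage_mono Metric.ball_subset_closedBall)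
  have hKt : K ⊆ (extChartAt I p).target := hKcl.trans hsub
  -- the chart density
  set f := Literature.Geometry.Kaehler.MForm.chartDensity p α with hf
  have hfs : ContDiff ℝ ∞ f := Literature.Geometry.Kaehler.MForm.contDiff_chartDensity p hα hKc.isClosed hKt hK
  have hfsupp : tsupport f ⊆ K := Literature.Geometry.Kaehler.MForm.tsupport_chartDensity_subset p α hKc.isClosed hK
  have hfc : HasCompactSupport f := IsCompact.of_isClosed_subset hKc (isClosed_tsupport _) hfsupp
  have hfint : ∫ y, f y ∂e.addHaar = 0 := by
    have h1 := Literature.Geometry.Kaehler.MForm.integral_eq_chartDensity o p hD hα hKc hKt hK fun y hy ↦ hsign y (hKcl hy)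
    rw [hint] at h1
    exact (mul_eq_zero.1 h1.symm).resolve_left hε
  -- the coordinate box containing the ball
  rcases le_or_gt r 0 with hr | hr
  · -- degenerate radius: `K = ∅`, `α = 0`
    have hK0 : K = ∅ := by
      refine eq_empty_of_forall_notMem fun y hy ↦ ?_
      have := hKb hy
      rw [mem_preimage, Metric.mem_ball] at this
      linarith [dist_nonneg (x := A y) (y := c)]
    refine ⟨0, Literature.Geometry.Kaehler.isSmoothForm_zero, ?_⟩
    rw [Literature.Geometry.Kaehler.mextDeriv_zero]
    funext x
    by_contra h
    have := (hK x (Ne.symm h)).2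
    rw [hK0] at this
    exact this
  have hbox : A ⁻¹' Metric.ball c r = A ⁻¹' Set.pi univ (fun j ↦ Ioo (c j - r) (c j + r)) := by
    rw [ball_pi _ hr]
    congr 1
    ext w
    simp only [mem_univ_pi, Real.ball_eq_Ioo]
  obtain ⟨η, hηs, hηc, hηsupp, hdη⟩ := exists_extDeriv_eq_smul_of_integral_eq_zero e D
    (fun j ↦ c j - r) (fun j ↦ c j + r) hfs hfc (by rw [← hbox]; exact hfsupp.trans hKb) hfint
  have hηt : tsupport η ⊆ (extChartAt I p).target := by
    rw [← hbox] at hηsupp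
    exact hηsupp.trans ((preimage_mono Metric.ball_subset_closedBall).trans hsub)
  refine ⟨Literature.Geometry.Kaehler.MForm.ofChart p η, isSmoothForm_ofChart p hηs hηc hηt, ?_⟩
  rw [mextDeriv_ofChart p hηs hηc hηt, hdη]
  have hα0 : ∀ x ∉ (extChartAt I p).source, α x = 0 := fun x hx ↦ by
    by_contra h
    exact hx (hK x h).1
  exact (Literature.Geometry.Kaehler.MForm.eq_ofChart_chartDensity_smul p hD hα0).symm

/-- **Local exactness** (both cases): under the hypotheses of
`MForm.mem_exactSmoothForms_of_integral_eq_zero_succ` in any dimension `n`, the form is exact.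
[cite: LeeSmoothManifolds2013, Thm. 17.30] -/
theorem _root_.Literature.Geometry.Kaehler.MForm.mem_exactSmoothForms_of_integral_eq_zero {p : M} {r ε : ℝ} (hε : ε ≠ 0)
    (hsub : (modelBasis E n).equivFunL ⁻¹' Metric.closedBall
      ((modelBasis E n).equivFunL (extChartAt I p p)) r ⊆ (extChartAt I p).target)
    (hsign : ∀ y ∈ (modelBasis E n).equivFunL ⁻¹' Metric.closedBall
      ((modelBasis E n).equivFunL (extChartAt I p p)) r, chartSign o p y = ε)
    {α : Literature.Geometry.Kaehler.MForm I M ℝ n} (hα : Literature.Geometry.Kaehler.IsSmoothForm α) {K : Set E} (hKc : IsCompact K)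
    (hKb : K ⊆ (modelBasis E n).equivFunL ⁻¹' Metric.ball
      ((modelBasis E n).equivFunL (extChartAt I p p)) r)
    (hK : ∀ x, α x ≠ 0 → x ∈ (extChartAt I p).source ∧ extChartAt I p x ∈ K)
    (hint : α.integral o = 0) :
    α ∈ Literature.Geometry.Kaehler.exactSmoothForms I M ℝ n := by
  cases n with
  | zero =>
    have hKt : K ⊆ (extChartAt I p).target :=
      (hKb.trans (preimage_mono Metric.ball_subset_closedBall)).trans hsub
    rw [Literature.Geometry.Kaehler.MForm.eq_zero_of_integral_eq_zero_of_finrank_zero o hε hα hKc hKt hK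
      (fun y hy ↦ hsign y (hKb.trans (preimage_mono Metric.ball_subset_closedBall) hy)) hint]
    exact Submodule.zero_mem _
  | succ m =>
    obtain ⟨β, hβ, rfl⟩ := Literature.Geometry.Kaehler.MForm.mem_exactSmoothForms_of_integral_eq_zero_succ o hε hsub hsign hα
      hKc hKb hK hint
    exact Submodule.subset_span ⟨β, hβ, rfl⟩

/-- **Bump forms**: in an oriented coordinate ball around `p`, for every open `O` (inside the
open coordinate ball) and `z₀ ∈ O` there is a smooth top form with nonzero integral supported
in the preimage of a compact subset of `O` (Lee (2013), proof of Thm. 17.30: "`θ₀ = f dx¹ ∧ ⋯ ∧ dxⁿ`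
with `I(θ₀) > 0`"). [cite: LeeSmoothManifolds2013, Thm. 17.30] -/
theorem _root_.Literature.Geometry.Kaehler.MForm.exists_bump {p : M} {r ε : ℝ} (hε : ε ≠ 0)
    (hsub : (modelBasis E n).equivFunL ⁻¹' Metric.closedBall
      ((modelBasis E n).equivFunL (extChartAt I p p)) r ⊆ (extChartAt I p).target)
    (hsign : ∀ y ∈ (modelBasis E n).equivFunL ⁻¹' Metric.closedBall
      ((modelBasis E n).equivFunL (extChartAt I p p)) r, chartSign o p y = ε)
    {O : Set E} (hO : IsOpen O)
    (hOb : O ⊆ (modelBasis E n).equivFunL ⁻¹' Metric.ball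
      ((modelBasis E n).equivFunL (extChartAt I p p)) r)
    {z₀ : E} (hz₀ : z₀ ∈ O) :
    ∃ γ : Literature.Geometry.Kaehler.MForm I M ℝ n, Literature.Geometry.Kaehler.IsSmoothForm γ ∧ γ.integral o ≠ 0 ∧ ∃ Kg : Set E, IsCompact Kg ∧
      Kg ⊆ O ∧ ∀ x, γ x ≠ 0 → x ∈ (extChartAt I p).source ∧ extChartAt I p x ∈ Kg := by
  set e := modelBasis E n with he
  set D := basisDetL e with hDdef
  have hD : D e = 1 := basisDetL_self e
  obtain ⟨g, hgsupp, hgc, hgs, hgrange, hg1⟩ := exists_contDiff_tsupport_subset (n := ⊤)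
    (hO.mem_nhds hz₀)
  have hOt : O ⊆ (extChartAt I p).target :=
    (hOb.trans (preimage_mono Metric.ball_subset_closedBall)).trans hsub
  have hgt : tsupport g ⊆ (extChartAt I p).target := hgsupp.trans hOt
  have hηs : ContDiff ℝ ∞ fun y ↦ g y • D := hgs.smul contDiff_const
  have hηc : HasCompactSupport fun y ↦ g y • D := hgc.smul_right
  have hηt : tsupport (fun y ↦ g y • D) ⊆ (extChartAt I p).target :=
    (tsupport_smul_subset_left _ _).trans hgt
  refine ⟨Literature.Geometry.Kaehler.MForm.ofChart p (fun y ↦ g y • D), isSmoothForm_ofChart p hηs hηc hηt, ?_,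
    tsupport g, hgc, hgsupp, ?_⟩
  · rw [Literature.Geometry.Kaehler.MForm.integral_ofChart_smul o p hD hgs.continuous hgc hgt
      (fun y hy ↦ hsign y ((hOb.trans (preimage_mono Metric.ball_subset_closedBall)) (hgsupp hy)))]
    refine mul_ne_zero hε (ne_of_gt ?_)
    have hnn : ∀ y, 0 ≤ g y := fun y ↦ (hgrange (mem_range_self y)).1
    rw [integral_pos_iff_support_of_nonneg hnn (hgs.continuous.integrable_of_hasCompactSupport hgc)]
    exact hgs.continuous.isOpen_support.measure_pos _ ⟨z₀, by simp [hg1]⟩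
  · intro x hx
    obtain ⟨hxs, hne⟩ := Literature.Geometry.Kaehler.MForm.mem_source_of_ofChart_ne_zero p _ hx
    refine ⟨hxs, subset_tsupport g ?_⟩
    intro h0
    apply hne
    simp only [h0, zero_smul]

omit [FiniteDimensional ℝ E] [Fact (finrank ℝ E = n)] [MeasurableSpace E] [BorelSpace E] [T2Space M]
  [SigmaCompactSpace M] [IsManifold I ∞ M] [CompactSpace M] [I.Boundaryless] in
/-- Support control of `α - c • β` in a chart from support control of `α` and `β`. [folklore] -/
theorem _root_.Literature.Geometry.Kaehler.MForm.control_sub_smul {p : M} {α β : Literature.Geometry.Kaehler.MForm I M ℝ n} {Kα Kβ : Set E} (c : ℝ)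
    (hα : ∀ x, α x ≠ 0 → x ∈ (extChartAt I p).source ∧ extChartAt I p x ∈ Kα)
    (hβ : ∀ x, β x ≠ 0 → x ∈ (extChartAt I p).source ∧ extChartAt I p x ∈ Kβ) :
    ∀ x, (α - c • β) x ≠ 0 → x ∈ (extChartAt I p).source ∧ extChartAt I p x ∈ Kα ∪ Kβ := by
  intro x hx
  by_cases hb : α x = 0
  · have hg : β x ≠ 0 := by
      intro hg
      apply hx
      simp only [Pi.sub_apply, Pi.smul_apply, hb, hg, smul_zero, sub_zero]
    obtain ⟨hs, hk⟩ := hβ x hg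
    exact ⟨hs, Or.inr hk⟩
  · obtain ⟨hs, hk⟩ := hα x hb
    exact ⟨hs, Or.inl hk⟩

/-- **Chain step** (Lee (2013), proof of Thm. 17.30, inductive step with the auxiliary form
`θ` supported in `M_k ∩ U_{k+1}`): if the oriented coordinate balls around `p` and `q` meet,
then the bump forms `βp`, `βq` at `p` and `q` are proportional modulo exact forms.
[cite: LeeSmoothManifolds2013, Thm. 17.30] -/
theorem _root_.Literature.Geometry.Kaehler.MForm.exists_sub_smul_mem_exactSmoothForms (ho : IsContinuousOrientation o)
    (hadd : Literature.Geometry.Kaehler.MForm.integral_add o) {p q : M} {rp rq εp εq : ℝ} (hεp : εp ≠ 0) (hεq : εq ≠ 0)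
    (hsubp : (modelBasis E n).equivFunL ⁻¹' Metric.closedBall
      ((modelBasis E n).equivFunL (extChartAt I p p)) rp ⊆ (extChartAt I p).target)
    (hsignp : ∀ y ∈ (modelBasis E n).equivFunL ⁻¹' Metric.closedBall
      ((modelBasis E n).equivFunL (extChartAt I p p)) rp, chartSign o p y = εp)
    (hsubq : (modelBasis E n).equivFunL ⁻¹' Metric.closedBall
      ((modelBasis E n).equivFunL (extChartAt I q q)) rq ⊆ (extChartAt I q).target)
    (hsignq : ∀ y ∈ (modelBasis E n).equivFunL ⁻¹' Metric.closedBall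
      ((modelBasis E n).equivFunL (extChartAt I q q)) rq, chartSign o q y = εq)
    {βp βq : Literature.Geometry.Kaehler.MForm I M ℝ n} (hβp : Literature.Geometry.Kaehler.IsSmoothForm βp) (hβq : Literature.Geometry.Kaehler.IsSmoothForm βq)
    (hβq0 : βq.integral o ≠ 0)
    {Kp : Set E} (hKpc : IsCompact Kp) (hKpb : Kp ⊆ (modelBasis E n).equivFunL ⁻¹' Metric.ball
      ((modelBasis E n).equivFunL (extChartAt I p p)) rp)
    (hKp : ∀ x, βp x ≠ 0 → x ∈ (extChartAt I p).source ∧ extChartAt I p x ∈ Kp)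
    {Kq : Set E} (hKqc : IsCompact Kq) (hKqb : Kq ⊆ (modelBasis E n).equivFunL ⁻¹' Metric.ball
      ((modelBasis E n).equivFunL (extChartAt I q q)) rq)
    (hKq : ∀ x, βq x ≠ 0 → x ∈ (extChartAt I q).source ∧ extChartAt I q x ∈ Kq)
    (hne : ((extChartAt I p).source ∩ extChartAt I p ⁻¹' ((modelBasis E n).equivFunL ⁻¹'
        Metric.ball ((modelBasis E n).equivFunL (extChartAt I p p)) rp) ∩
      ((extChartAt I q).source ∩ extChartAt I q ⁻¹' ((modelBasis E n).equivFunL ⁻¹'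
        Metric.ball ((modelBasis E n).equivFunL (extChartAt I q q)) rq))).Nonempty) :
    ∃ c : ℝ, βp - c • βq ∈ Literature.Geometry.Kaehler.exactSmoothForms I M ℝ n := by
  set A := (modelBasis E n).equivFunL with hA
  set Bp := A ⁻¹' Metric.ball (A (extChartAt I p p)) rp with hBp
  set Bq := A ⁻¹' Metric.ball (A (extChartAt I q q)) rq with hBq
  set Vp := (extChartAt I p).source ∩ extChartAt I p ⁻¹' Bp with hVp
  set Vq := (extChartAt I q).source ∩ extChartAt I q ⁻¹' Bq with hVq
  obtain ⟨x₀, ⟨hx₀p, hx₀pb⟩, ⟨hx₀q, hx₀qb⟩⟩ := hne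
  have hVp_open : IsOpen Vp := (continuousOn_extChartAt p).isOpen_inter_preimage
    (isOpen_extChartAt_source p) (Metric.isOpen_ball.preimage A.continuous)
  have hVq_open : IsOpen Vq := (continuousOn_extChartAt q).isOpen_inter_preimage
    (isOpen_extChartAt_source q) (Metric.isOpen_ball.preimage A.continuous)
  set O := (extChartAt I p).target ∩ (extChartAt I p).symm ⁻¹' (Vp ∩ Vq) with hO
  have hO_open : IsOpen O :=
    isOpen_extChartAt_target_inter_preimage (I := I) p (hVp_open.inter hVq_open)
  have hOb : O ⊆ Bp := by
    intro y hy
    have := hy.2.1.2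
    rwa [mem_preimage, (extChartAt I p).right_inv hy.1] at this
  have hz₀ : extChartAt I p x₀ ∈ O := by
    refine ⟨(extChartAt I p).map_source hx₀p, ?_⟩
    rw [mem_preimage, (extChartAt I p).left_inv hx₀p]
    exact ⟨⟨hx₀p, hx₀pb⟩, hx₀q, hx₀qb⟩
  obtain ⟨γ, hγs, hγ0, Kg, hKgc, hKgO, hKg⟩ := Literature.Geometry.Kaehler.MForm.exists_bump o hεp hsubp hsignp hO_open hOb hz₀
  -- control of `γ` in the chart at `q`
  have hKg_sub : (extChartAt I p).symm '' Kg ⊆ Vp ∩ Vq := by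
    rintro _ ⟨y, hy, rfl⟩
    exact (hKgO hy).2
  set Kq' := extChartAt I q '' ((extChartAt I p).symm '' Kg) with hKq'
  have hKq'c : IsCompact Kq' := by
    refine (hKgc.image_of_continuousOn ((continuousOn_extChartAt_symm p).mono
      fun y hy ↦ (hKgO hy).1)).image_of_continuousOn ((continuousOn_extChartAt q).mono ?_)
    exact fun x hx ↦ (hKg_sub hx).2.1
  have hKq'b : Kq' ⊆ Bq := by
    rintro _ ⟨x, hx, rfl⟩
    exact (hKg_sub hx).2.2
  have hKgq : ∀ x, γ x ≠ 0 → x ∈ (extChartAt I q).source ∧ extChartAt I q x ∈ Kq' := by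
    intro x hx
    obtain ⟨hxs, hxK⟩ := hKg x hx
    have hx' : x ∈ (extChartAt I p).symm '' Kg := ⟨_, hxK, (extChartAt I p).left_inv hxs⟩
    exact ⟨(hKg_sub hx').2.1, x, hx', rfl⟩
  -- the two local exactness statements
  set cp' := βp.integral o / γ.integral o with hcp'
  set cq' := βq.integral o / γ.integral o with hcq'
  have h1 : βp - cp' • γ ∈ Literature.Geometry.Kaehler.exactSmoothForms I M ℝ n := by
    refine Literature.Geometry.Kaehler.MForm.mem_exactSmoothForms_of_integral_eq_zero o hεp hsubp hsignp
      ((Literature.Geometry.Kaehler.smoothForms I M ℝ n).sub_mem hβp ((Literature.Geometry.Kaehler.smoothForms I M ℝ n).smul_mem _ hγs))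
      (hKpc.union hKgc) (union_subset hKpb (hKgO.trans hOb)) (Literature.Geometry.Kaehler.MForm.control_sub_smul cp' hKp hKg) ?_
    rw [Literature.Geometry.Kaehler.MForm.integral_sub_smul o ho hadd hβp hγs, hcp', div_mul_cancel₀ _ hγ0, sub_self]
  have h2 : βq - cq' • γ ∈ Literature.Geometry.Kaehler.exactSmoothForms I M ℝ n := by
    refine Literature.Geometry.Kaehler.MForm.mem_exactSmoothForms_of_integral_eq_zero o hεq hsubq hsignq
      ((Literature.Geometry.Kaehler.smoothForms I M ℝ n).sub_mem hβq ((Literature.Geometry.Kaehler.smoothForms I M ℝ n).smul_mem _ hγs))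
      (hKqc.union hKq'c) (union_subset hKqb hKq'b) (Literature.Geometry.Kaehler.MForm.control_sub_smul cq' hKq hKgq) ?_
    rw [Literature.Geometry.Kaehler.MForm.integral_sub_smul o ho hadd hβq hγs, hcq', div_mul_cancel₀ _ hγ0, sub_self]
  have hcq0 : cq' ≠ 0 := div_ne_zero hβq0 hγ0
  refine ⟨cp' / cq', ?_⟩
  have : βp - (cp' / cq') • βq = (βp - cp' • γ) - (cp' / cq') • (βq - cq' • γ) := by
    rw [smul_sub, smul_smul, div_mul_cancel₀ cp' hcq0]
    abel
  rw [this]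
  exact Submodule.sub_mem _ h1 (Submodule.smul_mem _ _ h2)

/-- **Injectivity of integration on top cohomology** (Lee (2013), Thm. 17.30): on a closed
connected oriented `n`-manifold, a smooth `n`-form with `∫_M α = 0` is exact. Proof: oriented
coordinate balls `V p`, bump forms `β p`, the chain step makes
`T = {p | β p ≡ c • β p₀ mod exact}` clopen hence everything (`M` connected); a finite smooth
partition of unity subordinate to the `V p` reduces `α` to forms supported in single balls, which
are handled by local exactness. Uses the named facts `MForm.integral_add` and
`MForm.integral_eq_zero_of_mem_exactSmoothForms` (Stokes) as hypotheses, as in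
`deRhamCohomology.integral`. [cite: LeeSmoothManifolds2013, Thm. 17.30] -/
theorem _root_.Literature.Geometry.Kaehler.MForm.mem_exactSmoothForms_of_integral_eq_zero_of_connected [ConnectedSpace M]
    [Nonempty M] (ho : IsContinuousOrientation o) (hadd : Literature.Geometry.Kaehler.MForm.integral_add o)
    (hex : Literature.Geometry.Kaehler.MForm.integral_eq_zero_of_mem_exactSmoothForms o) {α : Literature.Geometry.Kaehler.MForm I M ℝ n}
    (hα : Literature.Geometry.Kaehler.IsSmoothForm α) (hint : α.integral o = 0) : α ∈ Literature.Geometry.Kaehler.exactSmoothForms I M ℝ n := by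
  set A := (modelBasis E n).equivFunL with hA
  choose r hr ε hε hsub hsign using exists_chartSign_const_ball o ho
  set V : M → Set M := fun p ↦ (extChartAt I p).source ∩ extChartAt I p ⁻¹'
    (A ⁻¹' Metric.ball (A (extChartAt I p p)) (r p)) with hV
  have hVopen : ∀ p, IsOpen (V p) := fun p ↦ (continuousOn_extChartAt p).isOpen_inter_preimage
    (isOpen_extChartAt_source p) (Metric.isOpen_ball.preimage A.continuous)
  have hpV : ∀ p, p ∈ V p := fun p ↦ ⟨mem_extChartAt_source p, by
    simp only [mem_preimage, Metric.mem_ball, dist_self, hr p]⟩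
  -- bump forms at every point
  have hbump : ∀ p, ∃ γ : Literature.Geometry.Kaehler.MForm I M ℝ n, Literature.Geometry.Kaehler.IsSmoothForm γ ∧ γ.integral o ≠ 0 ∧ ∃ Kg : Set E,
      IsCompact Kg ∧ Kg ⊆ A ⁻¹' Metric.ball (A (extChartAt I p p)) (r p) ∧
      ∀ x, γ x ≠ 0 → x ∈ (extChartAt I p).source ∧ extChartAt I p x ∈ Kg := fun p ↦
    Literature.Geometry.Kaehler.MForm.exists_bump o (hε p) (hsub p) (hsign p) (Metric.isOpen_ball.preimage A.continuous)
      Subset.rfl (z₀ := extChartAt I p p) (by simp only [mem_preimage, Metric.mem_ball, dist_self, hr p])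
  choose β hβs hβ0 Kβ hKβc hKβb hKβ using hbump
  have hchain : ∀ p q, (V p ∩ V q).Nonempty → ∃ c : ℝ, β p - c • β q ∈ Literature.Geometry.Kaehler.exactSmoothForms I M ℝ n :=
    fun p q hne ↦ Literature.Geometry.Kaehler.MForm.exists_sub_smul_mem_exactSmoothForms o ho hadd (hε p) (hε q) (hsub p)
      (hsign p) (hsub q) (hsign q) (hβs p) (hβs q) (hβ0 q) (hKβc p) (hKβb p) (hKβ p) (hKβc q)
      (hKβb q) (hKβ q) hne
  obtain ⟨p₀⟩ := (inferInstance : Nonempty M)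
  -- the clopen set `T`
  set T : Set M := {p | ∃ c : ℝ, β p - c • β p₀ ∈ Literature.Geometry.Kaehler.exactSmoothForms I M ℝ n} with hT
  have hT0 : p₀ ∈ T := ⟨1, by rw [one_smul, sub_self]; exact Submodule.zero_mem _⟩
  have hstep : ∀ p q, (V p ∩ V q).Nonempty → q ∈ T → p ∈ T := by
    rintro p q hne ⟨c, hc⟩
    obtain ⟨c', hc'⟩ := hchain p q hne
    refine ⟨c' * c, ?_⟩
    have : β p - (c' * c) • β p₀ = (β p - c' • β q) + c' • (β q - c • β p₀) := by
      rw [mul_smul, smul_sub]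
      abel
    rw [this]
    exact Submodule.add_mem _ hc' (Submodule.smul_mem _ _ hc)
  have hTopen : IsOpen T := by
    rw [isOpen_iff_mem_nhds]
    intro p hp
    filter_upwards [(hVopen p).mem_nhds (hpV p)] with q hq
    exact hstep q p ⟨q, hpV q, hq⟩ hp
  have hTclosed : IsClosed T := by
    refine closure_subset_iff_isClosed.1 fun p hp ↦ ?_
    rw [mem_closure_iff_nhds] at hp
    obtain ⟨q, hqV, hqT⟩ := hp (V p) ((hVopen p).mem_nhds (hpV p))
    exact hstep p q ⟨q, hqV, hpV q⟩ hqT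
  have hTuniv : T = univ := IsClopen.eq_univ ⟨hTclosed, hTopen⟩ ⟨p₀, hT0⟩
  have hcoef : ∀ p, ∃ c : ℝ, β p - c • β p₀ ∈ Literature.Geometry.Kaehler.exactSmoothForms I M ℝ n := fun p ↦ by
    have : p ∈ T := by rw [hTuniv]; exact mem_univ p
    exact this
  choose cc hcc using hcoef
  -- a finite smooth partition of unity subordinate to the balls
  obtain ⟨ψ, hψ⟩ := SmoothPartitionOfUnity.exists_isSubordinate I isClosed_univ V hVopen
    (fun p _ ↦ mem_iUnion.2 ⟨p, hpV p⟩)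
  have hfin : {i : M | (support (ψ i)).Nonempty}.Finite :=
    ψ.locallyFinite.finite_nonempty_of_compact
  set S := hfin.toFinset with hS
  have hSmem : ∀ i, i ∉ S → ∀ x, ψ i x = 0 := by
    intro i hi x
    by_contra hx
    exact hi (hfin.mem_toFinset.2 ⟨x, hx⟩)
  have hsum1 : ∀ x : M, ∑ i ∈ S, ψ i x = 1 := by
    intro x
    have hsub' : support (fun i ↦ ψ i x) ⊆ (S : Set M) := by
      intro i hi
      simp only [Finset.mem_coe]
      by_contra h
      exact hi (hSmem i h x)
    exact (finsum_eq_sum_of_support_subset _ hsub').symm.trans (ψ.sum_eq_one (mem_univ x))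
  have hαi : ∀ i, Literature.Geometry.Kaehler.IsSmoothForm ((ψ i : M → ℝ) • α) := fun i ↦
    Literature.Geometry.Kaehler.IsSmoothForm.fun_smul (ContMDiffMap.contMDiff (ψ i)) hα
  have hαsum : ∑ i ∈ S, (ψ i : M → ℝ) • α = α := by
    funext x
    rw [Finset.sum_apply]
    simp only [Pi.smul_apply']
    rw [← Finset.sum_smul, hsum1, one_smul]
  have hKi : ∀ i, IsCompact (extChartAt I i '' tsupport (ψ i)) := fun i ↦
    (isClosed_tsupport _).isCompact.image_of_continuousOn
      ((continuousOn_extChartAt i).mono fun x hx ↦ (hψ i hx).1)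
  have hKib : ∀ i, extChartAt I i '' tsupport (ψ i) ⊆
      A ⁻¹' Metric.ball (A (extChartAt I i i)) (r i) := by
    rintro i _ ⟨x, hx, rfl⟩
    exact (hψ i hx).2
  have hKictl : ∀ i x, ((ψ i : M → ℝ) • α) x ≠ 0 →
      x ∈ (extChartAt I i).source ∧ extChartAt I i x ∈ extChartAt I i '' tsupport (ψ i) := by
    intro i x hx
    have hψx : ψ i x ≠ 0 := fun h ↦ hx (by simp only [Pi.smul_apply', h, zero_smul])
    have hxt : x ∈ tsupport (ψ i) := subset_tsupport _ hψx
    exact ⟨(hψ i hxt).1, x, hxt, rfl⟩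
  -- local exactness of each piece, corrected by the bump form
  set d : M → ℝ := fun i ↦ ((ψ i : M → ℝ) • α).integral o / (β i).integral o with hd
  have hloc : ∀ i, (ψ i : M → ℝ) • α - d i • β i ∈ Literature.Geometry.Kaehler.exactSmoothForms I M ℝ n := by
    intro i
    refine Literature.Geometry.Kaehler.MForm.mem_exactSmoothForms_of_integral_eq_zero o (hε i) (hsub i) (hsign i)
      ((Literature.Geometry.Kaehler.smoothForms I M ℝ n).sub_mem (hαi i) ((Literature.Geometry.Kaehler.smoothForms I M ℝ n).smul_mem _ (hβs i)))
      ((hKi i).union (hKβc i)) (union_subset (hKib i) (hKβb i))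
      (Literature.Geometry.Kaehler.MForm.control_sub_smul (d i) (hKictl i) (hKβ i)) ?_
    rw [Literature.Geometry.Kaehler.MForm.integral_sub_smul o ho hadd (hαi i) (hβs i), hd]
    simp only
    rw [div_mul_cancel₀ _ (hβ0 i), sub_self]
  -- assemble
  set Dc := ∑ i ∈ S, d i * cc i with hDc
  have hmem : α - Dc • β p₀ ∈ Literature.Geometry.Kaehler.exactSmoothForms I M ℝ n := by
    have hids : ∀ i, ((ψ i : M → ℝ) • α - d i • β i) + d i • (β i - cc i • β p₀) =
        (ψ i : M → ℝ) • α - (d i * cc i) • β p₀ := by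
      intro i
      rw [smul_sub, smul_smul]
      abel
    have : α - Dc • β p₀ =
        ∑ i ∈ S, (((ψ i : M → ℝ) • α - d i • β i) + d i • (β i - cc i • β p₀)) := by
      rw [Finset.sum_congr rfl fun i _ ↦ hids i, Finset.sum_sub_distrib, hαsum,
        ← Finset.sum_smul]
    rw [this]
    exact Submodule.sum_mem _ fun i _ ↦
      Submodule.add_mem _ (hloc i) (Submodule.smul_mem _ _ (hcc i))
  have hI := Literature.Geometry.Kaehler.MForm.integral_sub_smul o ho hadd hα (hβs p₀) Dc
  rw [hex ho hmem, hint, zero_sub, eq_comm, neg_eq_zero, mul_eq_zero] at hI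
  have hDc0 : Dc = 0 := hI.resolve_right (hβ0 p₀)
  rw [hDc0, zero_smul, sub_zero] at hmem
  exact hmem

/-- **Existence of a top form with nonzero integral** on a nonempty closed oriented manifold
(a chart bump form; Lee (2013), proof of Thm. 17.30, surjectivity of `I`).
[cite: LeeSmoothManifolds2013, Thm. 17.30] -/
theorem _root_.Literature.Geometry.Kaehler.MForm.exists_isSmoothForm_integral_ne_zero [Nonempty M] (ho : IsContinuousOrientation o) :
    ∃ β : Literature.Geometry.Kaehler.MForm I M ℝ n, Literature.Geometry.Kaehler.IsSmoothForm β ∧ β.integral o ≠ 0 := by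
  obtain ⟨p₀⟩ := (inferInstance : Nonempty M)
  obtain ⟨r, hr, ε, hε, hsub, hsign⟩ := exists_chartSign_const_ball o ho p₀
  obtain ⟨β, hβs, hβ0, -⟩ := Literature.Geometry.Kaehler.MForm.exists_bump o hε hsub hsign
    (Metric.isOpen_ball.preimage (modelBasis E n).equivFunL.continuous) Subset.rfl
    (z₀ := extChartAt I p₀ p₀) (by simp only [mem_preimage, Metric.mem_ball, dist_self, hr])
  exact ⟨β, hβs, hβ0⟩

/-- **Top de Rham cohomology of a closed connected oriented manifold** (Lee (2013),
Thm. 17.30–17.31): the named fact `Literature.Geometry.Kaehler.deRhamCohomology.integral_bijective` holds, i.e.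
integration `H^n_dR(M) → ℝ` is bijective. Surjective by a chart bump form with nonzero
integral; injective by `MForm.mem_exactSmoothForms_of_integral_eq_zero_of_connected`.
[cite: LeeSmoothManifolds2013, Thm. 17.30] -/
theorem _root_.Literature.Geometry.Kaehler.deRhamCohomology.integral_bijective_holds : Literature.Geometry.Kaehler.deRhamCohomology.integral_bijective o := by
  intro _ _ ho hadd hex
  obtain ⟨β, hβs, hβ0⟩ := Literature.Geometry.Kaehler.MForm.exists_isSmoothForm_integral_ne_zero o ho
  have hβc : β ∈ Literature.Geometry.Kaehler.closedSmoothForms I M ℝ n := ⟨hβs, Literature.Geometry.Kaehler.mextDeriv_eq_zero_of_top_degree β⟩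
  constructor
  · rw [injective_iff_map_eq_zero]
    intro a ha
    obtain ⟨α, rfl⟩ := Literature.Geometry.Kaehler.deRhamCohomology.mk_surjective a
    rw [Literature.Geometry.Kaehler.deRhamCohomology.integral_mk] at ha
    have hmem := Literature.Geometry.Kaehler.MForm.mem_exactSmoothForms_of_integral_eq_zero_of_connected o ho hadd hex α.2.1 ha
    change Submodule.mkQ _ α = 0
    rw [Submodule.mkQ_apply, Submodule.Quotient.mk_eq_zero, Submodule.mem_comap]
    exact hmem
  · intro t
    refine ⟨Literature.Geometry.Kaehler.deRhamCohomology.mk ⟨(t / β.integral o) • β,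
      (Literature.Geometry.Kaehler.closedSmoothForms I M ℝ n).smul_mem _ hβc⟩, ?_⟩
    rw [Literature.Geometry.Kaehler.deRhamCohomology.integral_mk]
    change Literature.Geometry.Kaehler.MForm.integral o ((t / β.integral o) • β) = t
    rw [Literature.Geometry.Kaehler.MForm.integral_smul, div_mul_cancel₀ t hβ0]

end TopCohomology

end Literature.NumberTheory.Transcendental
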